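import Literature.MathematicalPhysics.QuantumFieldTheory.BalabanImbrieJaffe1984to88.BIJ88Ineq5144SizeFree309
import Literature.MathematicalPhysics.QuantumFieldTheory.BalabanImbrieJaffe1984to88.BIJ88Ineq5144BoundedSizeToy
import Literature.MathematicalPhysics.QuantumFieldTheory.BalabanImbrieJaffe1984to88.BIJ88CubeProductDset306

/-!
# `BalabanImbrieJaffe1984to88.BIJ88Ineq5144SizeFreeCoupledToy` — T. Bałaban, J. Imbrie, A. Jaffe, *Effective action and cluster properties of the
abelian Higgs model*, Commun. Math. Phys. **114** (1988) 257–315 [BalabanImbrieJaffe1988], Sect. 5.14 (5.14.4) p. 309 [PDF 53] with Sect. 5.13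
p. 305–307 [PDF 49–51]: **THE (K5) NON-VACUITY CERTIFICATE OF THE SIZE-FREE INSTANCE ON A COUPLED DATUM** (owner ruling ROWS-C2-part2 v2.397
+ addendum; referee check (2)): `BIJ88Ineq5144SizeFree309.abs_locAct_actIn_le_rpow_sizeFree` APPLIED by the kernel on ONE datum with a
COUPLED precision and a NON-CONSTANT interaction slot whose all-orders letter is used, every letter evaluated, `β′ = 1 > 0`:
sites `Fin 2` = cubes (one site per cube), `Δ = [[1, 1/100],[1/100, 1]]` (one bond `h = 1/100` between the two cubes of `X″`; `m = 99/100`,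
`C₀ = 101/100`), no source, no χ-slot, ONE interaction slot in cube `0` with `V(φ) = −log(1 + ½ sin(λφ₀))`, `λ = θ_V = ϑ = e^{−1500}` (the
all-orders letter `A_Y(0,0) = 3/2`, `A_Y(0,n) = ½λⁿ` of `BIJ88Ineq5144BoundedSizeToy.exists_letter_logSin`, legs off cube `0` killed by locality),
`t = 1`, `e_k = 1/20`, `θ = 1/10`, `β′ = 1`, `H = ∅`, `X″ =` both cubes.  LETTERS: site pseudometric `d(0,1) = 1` (the bond is within the band),
local volume `z = 1`, rate `μ = 1` (Combes–Thomas smallness `(1/100)(e − 1) ≤ 99/200`), site lattice sum `Z = 2`; cube metric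
`cd(0,1) = 1/7000` with `r = 7000`, `r₀ = 0` (scale letter `r·cd − r₀ = 1 = d`), growth `C_g = 2`, `dim = 1`, `C₂ = 2` (so `c₀ = 4`,
`(c₀+1)! = 120`), `Z_c = Z_{c,2} = 2`, `z_c = s₀ = 1`; `θ_S = η = 0`, `A_χ = Λ = Λ_∞ = 1`, `a_χ = 0`, `A_V = 2`, `a_V = 1`, `s = 0`, `N_n = 8`,
`w =` the indicator of site `0` (`w₁ = 1`), `M = 0`; counting `λ′ = 1/10` (`λ′r₁ = 1399.8`), `F₁ = 0`, `Z_s = 8`, `G = 4e^{−1749.5}`,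
`ρ = 1/100`.  THE TENSION OF THE CLAUSE SET IS EXERCISED: the per-block ratio letter reads `(8/99)·e^{1/2}·e^{−λ′r₁/5}·e^{2·5!} =
(8/99)e^{−39.46} ≤ ρ² = 10⁻⁴`, the per-train smallness `(200/99)·ϑ·½R₁²·e^{λ′r₁} ≤ (100/99)·24²·e^{−100.2} ≤ 1`, the far gain
`e^{−(μ/8)(2r−1)} = e^{−1749.875} ≤ ϑ`, and the final smallness `(C₂+1)·A_V^{s₀}·ρ = 6/100 ≤ θ^{β′} = 1/10`.
* `exp_neg_le_inv_two_pow` (`e^{−x} ≤ 2^{−n}` for `n ≤ x`), `toy2_posDef_and_ge`, `p1_aux`;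
* the certificate **`abs_locAct_actIn_le_rpow_sizeFree_coupledToy`**.

statement-level skeleton of published theorems with citation tags; proofs where landed; nothing here is a claim about the Yang–Mills mass gap

PDF held: `paper:balaban1988-cmp114-bij-abelian-higgs-effective-action` (journal page = PDF page + 256); p. 309 (p0053 L12–28), p. 307 (p0051).
CITATION HEADER (lean-in-tree rule).  lit-balaban TYPED SKELETON (HOME `run/shared/lean/pub/lit-balaban/`), Phase 2, seat p36 (gen 23, unit
`lit-balaban-p36`); row **C2.Eq5.14.3-5.14.4** (member: the (K5) certificate of the size-free instance — owner ruling v2.397) of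
`HOME/lit-balaban-r16/ROWS-C2-part2.md` (owner r16, referee ref-5).  Theorem-only; no definitions, no `Prop` facts; axioms standard.  HONEST SCOPE:
non-vacuity only — a two-cube datum with ONE bond, no χ-slot (the χ-letters, shells, frame and ℓ^∞ letters are inhabited vacuously; a χ-slot
certificate needs a concrete `CutoffProfile`, NOT given), `H = ∅` (only `t`-multiplicity `0` is constrained), no source; the cube metric between the
two coupled cubes is the letter value `1/r` (the scale letter allows it); the truncated activity of the datum is not claimed non-zero.  NOT summit
progress; NOT continuum; NOT Clay.
-/

noncomputable section

namespace Literature.MathematicalPhysics.QuantumFieldTheory.BalabanImbrieJaffe1984to88.BIJ88Ineq5144SizeFreeCoupledToy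

open Finset Matrix Real
open scoped BigOperators
open BIJ88Sect5Statements (CutoffProfile)
open BIJ88SmoothFactors5133 (CbInf extCLM extCLM_apply)
open BIJ88WickSourceSmooth305 (dset)
open BIJ88SlotMomentsGauss308 (uD)
open BIJ88Eq5145CornerModel (slotB slotY mem_slotY)
open BIJ88Eq5145CornerUrsell (cubeIn)
open BIJ88W6PrimeVsupp (actIn)
open BIJ88Ineq5144Located (locAct)
open BIJ88CubeProductDset306 (dset_eq_zero_of_local)
open BIJ88Ineq5144BoundedSizeToy (cbInf_neg cbInf_log_one_add_half_sin exists_letter_logSin)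
open BIJ88Ineq5144SizeFree309 (abs_locAct_actIn_le_rpow_sizeFree)

/-! ## §1  Exponential arithmetic and the datum's precision -/

/-- `e^{−x} ≤ 2^{−n}` for `n ≤ x` (`2 ≤ e`). [folklore] [cite: BalabanImbrieJaffe1988, §5.13 p.307] -/
theorem exp_neg_le_inv_two_pow {x : ℝ} {n : ℕ} (h : (n : ℝ) ≤ x) : Real.exp (-x) ≤ ((2 : ℝ) ^ n)⁻¹ := by
  rw [Real.exp_neg]
  refine inv_anti₀ (by positivity) ?_
  calc (2 : ℝ) ^ n ≤ Real.exp 1 ^ n := pow_le_pow_left₀ (by norm_num) (by linarith [Real.add_one_le_exp (1 : ℝ)]) n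
    _ = Real.exp n := by rw [← Real.exp_nat_mul, mul_one]
    _ ≤ Real.exp x := Real.exp_le_exp.2 h

/-- the coupled `2 × 2` precision `[[1, 1/100],[1/100, 1]]` is positive definite with `Δ ≥ (99/100)·1`. [cite: BalabanImbrieJaffe1988, §5.13 p.305] -/
theorem toy2_posDef_and_ge :
    ((!![1, 1 / 100; 1 / 100, 1] : Matrix (Fin 2) (Fin 2) ℝ)).PosDef ∧
      ∀ φ : Fin 2 → ℝ, (99 / 100) * (φ ⬝ᵥ φ) ≤ φ ⬝ᵥ ((!![1, 1 / 100; 1 / 100, 1] : Matrix (Fin 2) (Fin 2) ℝ) *ᵥ φ) := by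
  have hq : ∀ φ : Fin 2 → ℝ, φ ⬝ᵥ ((!![1, 1 / 100; 1 / 100, 1] : Matrix (Fin 2) (Fin 2) ℝ) *ᵥ φ) =
      φ 0 ^ 2 + φ 1 ^ 2 + (2 / 100) * (φ 0 * φ 1) := fun φ => by
    simp [Matrix.mulVec, dotProduct, Fin.sum_univ_two]; ring
  have hn : ∀ φ : Fin 2 → ℝ, φ ⬝ᵥ φ = φ 0 ^ 2 + φ 1 ^ 2 := fun φ => by simp [dotProduct, Fin.sum_univ_two]; ring
  have hge : ∀ φ : Fin 2 → ℝ, (99 / 100) * (φ ⬝ᵥ φ) ≤ φ ⬝ᵥ ((!![1, 1 / 100; 1 / 100, 1] : Matrix (Fin 2) (Fin 2) ℝ) *ᵥ φ) := fun φ => by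
    rw [hq, hn]
    nlinarith [sq_nonneg (φ 0 + φ 1)]
  refine ⟨?_, hge⟩
  rw [Matrix.posDef_iff_dotProduct_mulVec]
  refine ⟨Matrix.IsHermitian.ext fun i j => by fin_cases i <;> fin_cases j <;> simp, fun x hx => ?_⟩
  rw [star_trivial]
  have hpos : 0 < x ⬝ᵥ x := by
    rw [hn]
    have : x 0 ≠ 0 ∨ x 1 ≠ 0 := by
      by_contra h
      push Not at h
      exact hx (by ext i; fin_cases i <;> simp [h.1, h.2])
    rcases this with h | h <;> positivity
  linarith [hge x]

/-- bookkeeping of the per-train smallness: `(200/99)·ϑ·(0·R + ½R²)·e ≤ 1` from `R ≤ 24` and `ϑ·e ≤ 2^{−100}`. [folklore]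
[cite: BalabanImbrieJaffe1988, §5.13 p.307 L14–16] -/
theorem p1_aux {ϑ R e : ℝ} (hR0 : 0 ≤ R) (hR : R ≤ 24) (hE : ϑ * e ≤ ((2 : ℝ) ^ 100)⁻¹) (hϑ : 0 ≤ ϑ) (he : 0 ≤ e) :
    2 / (99 / 100 : ℝ) * (ϑ * (0 * R + 1 / 2 * R ^ 2)) * e ≤ 1 := by
  have h1 : R ^ 2 ≤ 24 ^ 2 := pow_le_pow_left₀ hR0 hR 2
  calc 2 / (99 / 100 : ℝ) * (ϑ * (0 * R + 1 / 2 * R ^ 2)) * e = 100 / 99 * R ^ 2 * (ϑ * e) := by ring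
    _ ≤ 100 / 99 * (24 : ℝ) ^ 2 * ((2 : ℝ) ^ 100)⁻¹ := by gcongr
    _ ≤ 1 := by norm_num

/-! ## §2  The certificate -/

set_option maxHeartbeats 4000000 in
/-- **(K5): NON-VACUITY OF THE SIZE-FREE INSTANCE ON A COUPLED DATUM** — `BIJ88Ineq5144SizeFree309.abs_locAct_actIn_le_rpow_sizeFree` on the datum of
the module docstring (coupled `Δ`, the logSin interaction slot with `λ = θ_V = e^{−1500}`, `β′ = 1`), every binder inhabited and every hypothesis
discharged by the kernel, the tension `e^{2(c₀+1)!}` vs. `q = e^{−λ′r₁/(c₀+1)}` included: for every label map `γ′`,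
`|locAct (□∘γ′) g₃ (∅, X″)| ≤ (1/10)^{0 + 1·|X″∖∅|}` with `X″` the two coupled cubes. [cite: BalabanImbrieJaffe1988, (5.14.4) p.309 L12–28; §5.13 p.305–307] -/
theorem abs_locAct_actIn_le_rpow_sizeFree_coupledToy (adj : Fin 2 → Fin 2 → Prop) [DecidableRel adj] (χ : CutoffProfile) (p : ℝ)
    {S : Type*} [DecidableEq S]
    (γ' : S → ↥(slotB (∅ : Finset Unit) (univ : Finset Unit) (fun _ : ↥(∅ : Finset Unit) ⊕ ↥(univ : Finset Unit) => (0 : Fin 2))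
        (univ : Finset (Fin 2))) ⊕
      ↥(slotY (∅ : Finset Unit) (univ : Finset Unit) (fun _ : ↥(∅ : Finset Unit) ⊕ ↥(univ : Finset Unit) => (0 : Fin 2))
        (univ : Finset (Fin 2)))) :
    |locAct (cubeIn (fun _ : ↥(∅ : Finset Unit) ⊕ ↥(univ : Finset Unit) => (0 : Fin 2)) (univ : Finset (Fin 2)) ∘ γ')
        (actIn (fun x : Fin 2 => x) (!![1, 1 / 100; 1 / 100, 1] : Matrix (Fin 2) (Fin 2) ℝ) (fun _ : Fin 2 => (0 : ℝ)) adj χ p (1 / 20)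
          (∅ : Finset Unit) (fun (_ : Unit) (_ : Fin 2 → ℝ) => (0 : ℝ)) (fun _ : Unit => (1 : ℝ)) (univ : Finset Unit)
          (fun (_ : Unit) (φ : Fin 2 → ℝ) => -Real.log (1 + 1 / 2 * Real.sin (Real.exp (-1500) * φ 0)))
          (fun _ : ↥(∅ : Finset Unit) ⊕ ↥(univ : Finset Unit) => (0 : Fin 2)) (univ : Finset (Fin 2)) (univ : Finset (Fin 2)) 1 γ')
        (∅ : Finset S) (univ : Finset (Fin 2))| ≤
      (1 / 10 : ℝ) ^ (((∅ : Finset S).card : ℝ) + 1 * (((univ : Finset (Fin 2)) \ (∅ : Finset S).image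
        (cubeIn (fun _ : ↥(∅ : Finset Unit) ⊕ ↥(univ : Finset Unit) => (0 : Fin 2)) (univ : Finset (Fin 2)) ∘ γ')).card : ℝ)) := by
  obtain ⟨hΔ, hΔm⟩ := toy2_posDef_and_ge
  -- the empty χ-slot type and the unique interaction slot
  haveI hBe : IsEmpty ↥(slotB (∅ : Finset Unit) (univ : Finset Unit)
      (fun _ : ↥(∅ : Finset Unit) ⊕ ↥(univ : Finset Unit) => (0 : Fin 2)) (univ : Finset (Fin 2))) :=
    ⟨fun b => notMem_empty _ b.1.2⟩
  have hY₀ : (⟨(), mem_univ _⟩ : ↥(univ : Finset Unit)) ∈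
      slotY (∅ : Finset Unit) (univ : Finset Unit) (fun _ : ↥(∅ : Finset Unit) ⊕ ↥(univ : Finset Unit) => (0 : Fin 2))
        (univ : Finset (Fin 2)) := by rw [mem_slotY]; exact mem_univ _
  -- numerics
  have hl0 : (0 : ℝ) < Real.exp (-1500) := Real.exp_pos _
  have hl1 : Real.exp (-1500) ≤ 1 / 10 := (exp_neg_le_inv_two_pow (n := 4) (by norm_num)).trans (by norm_num)
  have hsite2 : (Fintype.card (BIJ88PolymerRep5134Gauss.Site (fun x : Fin 2 => x) (univ : Finset (Fin 2))) : ℝ) ≤ 2 := by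
    exact_mod_cast (Fintype.card_subtype_le _).trans (by simp)
  have hquarter : Real.exp (1 / 2 / 2 * (0 + 1)) ≤ 3 := (Real.exp_le_exp.2 (by norm_num)).trans (le_of_lt Real.exp_one_lt_three)
  -- the precision: upper letter and entries
  have hCΔ : ∀ v : Fin 2 → ℝ, v ⬝ᵥ ((!![1, 1 / 100; 1 / 100, 1] : Matrix (Fin 2) (Fin 2) ℝ) *ᵥ v) ≤ (101 / 100) * (v ⬝ᵥ v) := fun v => by
    have hq : v ⬝ᵥ ((!![1, 1 / 100; 1 / 100, 1] : Matrix (Fin 2) (Fin 2) ℝ) *ᵥ v) = v 0 ^ 2 + v 1 ^ 2 + (2 / 100) * (v 0 * v 1) := by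
      simp [Matrix.mulVec, dotProduct, Fin.sum_univ_two]; ring
    have hn : v ⬝ᵥ v = v 0 ^ 2 + v 1 ^ 2 := by simp [dotProduct, Fin.sum_univ_two]; ring
    rw [hq, hn]
    nlinarith [sq_nonneg (v 0 - v 1)]
  have hoff : ∀ x y : Fin 2, x ≠ y → ((!![1, 1 / 100; 1 / 100, 1] : Matrix (Fin 2) (Fin 2) ℝ)) x y = 1 / 100 := by
    intro x y hxy
    fin_cases x <;> fin_cases y <;> first | exact absurd rfl hxy | simp
  -- the interaction slot: `C_b^∞`, its all-orders letter, its locality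
  have hVcb : CbInf (fun φ : Fin 2 → ℝ => -Real.log (1 + 1 / 2 * Real.sin (Real.exp (-1500) * φ 0))) := by
    have h1 := (cbInf_neg (cbInf_log_one_add_half_sin hl0)).comp_clm (ContinuousLinearMap.proj (R := ℝ) (φ := fun _ : Fin 2 => ℝ) (0 : Fin 2))
    simpa only [ContinuousLinearMap.proj_apply] using h1
  obtain ⟨AY, hAY0, hAY00, hAY0n, hAYlet⟩ := exists_letter_logSin (fun x : Fin 2 => x) χ p (1 / 20)
    (slotB (∅ : Finset Unit) (univ : Finset Unit) (fun _ : ↥(∅ : Finset Unit) ⊕ ↥(univ : Finset Unit) => (0 : Fin 2))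
      (univ : Finset (Fin 2)))
    (fun b : ↥(∅ : Finset Unit) => (fun (_ : Unit) (_ : Fin 2 → ℝ) => (0 : ℝ)) b) (fun b : ↥(∅ : Finset Unit) => (fun _ : Unit => (1 : ℝ)) b)
    (slotY (∅ : Finset Unit) (univ : Finset Unit) (fun _ : ↥(∅ : Finset Unit) ⊕ ↥(univ : Finset Unit) => (0 : Fin 2))
      (univ : Finset (Fin 2)))
    (fun Y : ↥(univ : Finset Unit) => (fun (_ : Unit) (φ : Fin 2 → ℝ) => -Real.log (1 + 1 / 2 * Real.sin (Real.exp (-1500) * φ 0))) Y)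
    (univ : Finset (Fin 2)) (0 : Fin 2) hl0 (fun _ _ => rfl)
  -- THE INSTANCE, letter by letter
  refine abs_locAct_actIn_le_rpow_sizeFree (fun x : Fin 2 => x) (!![1, 1 / 100; 1 / 100, 1] : Matrix (Fin 2) (Fin 2) ℝ)
    (fun _ : Fin 2 => (0 : ℝ)) χ p (∅ : Finset Unit) (univ : Finset Unit) (fun _ : ↥(∅ : Finset Unit) ⊕ ↥(univ : Finset Unit) => (0 : Fin 2))
    adj (univ : Finset (Fin 2)) hΔ (m := 99 / 100) (C₀ := 101 / 100) (by norm_num) hΔm hCΔ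
    (ek := 1 / 20) (t := 1) (by norm_num) one_pos (by norm_num) (fun b hb => absurd hb (notMem_empty _))
    (fun b hb => absurd hb (notMem_empty _)) (fun _ _ => hVcb) (univ : Finset (Fin 2)) γ' ∅ (by simp) ⟨0, mem_univ _⟩
    (Sum.inr ⟨⟨(), mem_univ _⟩, hY₀⟩) (Λ := 1) one_pos
    (fun θ φ => by simp only [mul_zero, sum_const_zero, abs_zero]; positivity)
    (a := fun _ => 0) (a' := fun _ => 0) (fun _ => le_rfl)
    (A := fun τ m n => Sum.elim (fun _ => (1 : ℝ)) (fun _ => AY m n) τ)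
    (fun τ m n => by rcases τ with b | Y <;> simp [hAY0]) (fun b => (hBe.false b).elim)
    (w := fun τ x => Sum.elim (fun _ => (0 : ℝ)) (fun _ => if x.1 = 0 then (1 : ℝ) else 0) τ)
    (fun τ x => by rcases τ with b | Y <;> simp only [Sum.elim_inl, Sum.elim_inr] <;> (try split_ifs) <;> norm_num)
    (fun κ _ q b => (hBe.false b).elim) ?_
    (Fq := fun _ => 0) (fun q => by simp)
    -- the `Δ`-letters
    (fun x y : Fin 2 => if x = y then (0 : ℝ) else 1) (fun i => if_pos rfl)
    (fun i k => by by_cases h : i = k <;> simp [h, eq_comm])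
    (fun i j k => by fin_cases i <;> fin_cases j <;> fin_cases k <;> simp)
    (fun x y hxy => by
      by_cases h : x = y
      · subst h; norm_num at hxy
      · rw [if_neg h] at hxy; norm_num at hxy)
    (hΔoff := 1 / 100) (by norm_num) (fun x y hxy => by rw [hoff x y hxy, abs_of_pos (by norm_num)])
    (z := 1) (fun x => by
      refine le_trans ?_ (le_refl (1 : ℝ))
      have h1 : (univ.filter fun y : Fin 2 => y ≠ x ∧ (if x = y then (0 : ℝ) else 1) ≤ 1) ⊆ univ.erase x := fun y hy => by
        rw [mem_erase]; exact ⟨(mem_filter.1 hy).2.1, mem_univ _⟩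
      have h2 := card_le_card h1
      rw [card_erase_of_mem (mem_univ _), card_univ, Fintype.card_fin] at h2
      exact_mod_cast h2)
    (μ := 1) zero_le_one
    (by nlinarith [Real.exp_one_lt_three])
    (Z := 2)
    (fun y => by
      refine (sum_le_sum fun x _ => Real.exp_le_one_iff.2 ?_).trans ?_
      · rw [neg_nonpos]
        refine mul_nonneg (by norm_num) ?_
        split_ifs <;> norm_num
      · rw [sum_const, card_univ, nsmul_eq_mul, mul_one]; exact hsite2)
    -- the cube geometry
    (fun i i' : Fin 2 => if i = i' then (0 : ℝ) else 1 / 7000) (fun i i' => by split_ifs <;> norm_num)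
    (fun i i' => by by_cases h : i = i' <;> simp [h, eq_comm]) (r := 7000) (r₀ := 0) (by norm_num) (by norm_num)
    (fun x y => by
      show 7000 * (if x = y then (0 : ℝ) else 1 / 7000) - 0 ≤ if x = y then (0 : ℝ) else 1
      by_cases h : x = y
      · rw [if_pos h, if_pos h]; norm_num
      · rw [if_neg h, if_neg h]; norm_num)
    (Cg := 2) (dim := 1) two_pos one_ne_zero
    (fun i₀ kk hkk => by
      refine le_trans ?_ (by nlinarith [(by exact_mod_cast hkk : (1 : ℝ) ≤ kk)] : (2 : ℝ) ≤ 2 * (kk : ℝ) ^ 1)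
      exact_mod_cast (card_le_univ _).trans (by simp))
    (C2 := 2) (fun i => (card_le_univ _).trans (by simp))
    (Zc := 2) (fun i' => by
      refine (sum_le_sum fun i _ => Real.exp_le_one_iff.2 ?_).trans (by simp)
      rw [neg_nonpos]
      exact mul_nonneg (by norm_num) (le_max_right _ _))
    (Zc2 := 2) (fun i => by
      refine (sum_le_sum fun i' _ => Real.exp_le_one_iff.2 ?_).trans (by simp)
      rw [neg_nonpos]
      refine mul_nonneg (by norm_num) ?_
      split_ifs <;> norm_num)
    (zc := 1) (fun i => by rw [filter_eq' univ i, if_pos (mem_univ _), card_singleton, Nat.cast_one])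
    (s₀ := 1) (fun i _ => by
      refine (card_le_univ _).trans ?_
      rw [Fintype.card_sum, Fintype.card_eq_zero, zero_add]
      exact (Fintype.card_le_of_injective (fun Y => Y.1) Subtype.val_injective).trans (by simp))
    (F₀ := 0) (fun _ => le_rfl) (Λinf := 1) (fun b => (hBe.false b).elim)
    -- slot letters
    (θ := 1 / 10) (θS := 0) (θV := Real.exp (-1500)) (η := 0) (Aχ := 1) (AV := 2) (aχ := 0) (aV := 1) (sG := 0)
    (ϑ := Real.exp (-1500)) (w₁ := 1) (M := 0) (Nn := 8)
    le_rfl (by norm_num) (by norm_num) le_rfl le_rfl zero_le_one (by norm_num) zero_le_one (by norm_num) le_rfl hl0.le hl1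
    (by norm_num) zero_le_one le_rfl (by norm_num) hl0.le (hl1.trans (by norm_num))
    (by rw [Real.zero_rpow (by norm_num)]; exact hl0.le) le_rfl
    (Real.exp_le_exp.2 (by norm_num)) (by norm_num) (by norm_num)
    ?_ zero_le_one ?_
    (fun b => (hBe.false b).elim) (fun b => (hBe.false b).elim)
    (fun Y md nd hmd => by
      obtain rfl : md = 0 := Nat.le_zero.1 hmd
      simp only [Sum.elim_inr, zero_add, one_pow, Real.rpow_zero, mul_one]
      rcases Nat.eq_zero_or_pos nd with rfl | hnd1
      · rw [hAY00, pow_zero]; norm_num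
      · rw [hAY0n nd hnd1]
        nlinarith [pow_nonneg hl0.le nd])
    (fun b => (hBe.false b).elim) (fun τ => by simp)
    -- counting letters
    (lam' := 1 / 10) (G := Real.exp (-(1 / 2 / 2 / 2 * (2 * 7000 - (0 + 2)))) * Real.exp (1 / 2 / 2 / 2 * (0 + 2)) * (2 * 2))
    (ρ := 1 / 100) (β' := 1) (F₁ := 0) (Zs := 8)
    (by norm_num) (by norm_num) (by norm_num) (by norm_num)
    ?_ le_rfl ?_ (by norm_num) (by norm_num) ?_ zero_le_one (by rw [Real.rpow_one]; norm_num)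
  · -- hY: the interaction slot's legs; a leg off cube `0` is killed by locality
    intro κ _ q Y m D' φ
    simp only [Sum.elim_inr]
    by_cases hq : ∀ j ∈ D', (q j).1 = 0
    · rw [prod_congr rfl fun j hj => if_pos (hq j hj), prod_const_one, mul_one]
      exact hAYlet Y κ q m D' φ
    · push Not at hq
      obtain ⟨j, hj, hqj⟩ := hq
      have hG : CbInf fun ψ : BIJ88PolymerRep5134Gauss.Site (fun x : Fin 2 => x) (univ : Finset (Fin 2)) → ℝ =>
          uD χ p (1 / 20) (slotB (∅ : Finset Unit) (univ : Finset Unit)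
              (fun _ : ↥(∅ : Finset Unit) ⊕ ↥(univ : Finset Unit) => (0 : Fin 2)) (univ : Finset (Fin 2)))
            (fun b : ↥(∅ : Finset Unit) => (fun (_ : Unit) (_ : Fin 2 → ℝ) => (0 : ℝ)) b)
            (fun b : ↥(∅ : Finset Unit) => (fun _ : Unit => (1 : ℝ)) b)
            (slotY (∅ : Finset Unit) (univ : Finset Unit) (fun _ : ↥(∅ : Finset Unit) ⊕ ↥(univ : Finset Unit) => (0 : Fin 2))
              (univ : Finset (Fin 2)))
            (fun Y : ↥(univ : Finset Unit) => (fun (_ : Unit) (φ : Fin 2 → ℝ) =>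
              -Real.log (1 + 1 / 2 * Real.sin (Real.exp (-1500) * φ 0))) Y) 1 (Sum.inr Y) m
            (BIJ88PolymerRep5134Gauss.ext (fun x : Fin 2 => x) (univ : Finset (Fin 2)) ψ) := by
        have h := (BIJ88SlotFactorsSmooth308.cbInf_uD_inr χ p (ek := 1 / 20) (t := 1)
          (slotB (∅ : Finset Unit) (univ : Finset Unit) (fun _ : ↥(∅ : Finset Unit) ⊕ ↥(univ : Finset Unit) => (0 : Fin 2))
            (univ : Finset (Fin 2)))
          (Φ := fun b : ↥(∅ : Finset Unit) => (fun (_ : Unit) (_ : Fin 2 → ℝ) => (0 : ℝ)) b)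
          (c := fun b : ↥(∅ : Finset Unit) => (fun _ : Unit => (1 : ℝ)) b)
          (slotY (∅ : Finset Unit) (univ : Finset Unit) (fun _ : ↥(∅ : Finset Unit) ⊕ ↥(univ : Finset Unit) => (0 : Fin 2))
            (univ : Finset (Fin 2)))
          (V := fun Y : ↥(univ : Finset Unit) => (fun (_ : Unit) (φ : Fin 2 → ℝ) =>
            -Real.log (1 + 1 / 2 * Real.sin (Real.exp (-1500) * φ 0))) Y) Y hVcb m).comp_clm
          (extCLM (fun x : Fin 2 => x) (univ : Finset (Fin 2)))
        refine (congrArg CbInf (funext fun ψ => ?_)).mp h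
        rw [extCLM_apply]
      have hzero := dset_eq_zero_of_local (fun x : BIJ88PolymerRep5134Gauss.Site (fun x : Fin 2 => x) (univ : Finset (Fin 2)) => x.1)
        (i := (0 : Fin 2)) hG (fun φ' ψ' hφψ => by
          simp only [BIJ88Ineq5144BoundedSizeToy.uD_inr_eq]
          have h0 : BIJ88PolymerRep5134Gauss.ext (fun x : Fin 2 => x) (univ : Finset (Fin 2)) φ' 0 =
              BIJ88PolymerRep5134Gauss.ext (fun x : Fin 2 => x) (univ : Finset (Fin 2)) ψ' 0 := by
            show (if h : ((fun x : Fin 2 => x) 0) ∈ (univ : Finset (Fin 2)) then φ' ⟨0, h⟩ else 0) =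
              (if h : ((fun x : Fin 2 => x) 0) ∈ (univ : Finset (Fin 2)) then ψ' ⟨0, h⟩ else 0)
            rw [dif_pos (mem_univ _), dif_pos (mem_univ _)]
            exact hφψ ⟨0, mem_univ _⟩ rfl
          rw [h0])
        (fun j => Pi.single (q j) (1 : ℝ)) (D := D') hj (fun x hx => by
          rw [Pi.single_apply, if_neg]
          intro hxq
          exact hqj (by rw [← hxq]; exact hx))
      rw [hzero]
      simp only [abs_zero]
      exact mul_nonneg (hAY0 _ _) (prod_nonneg fun j _ => by split_ifs <;> norm_num)
  · -- hwloc
    intro τ x hx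
    rcases τ with b | Y
    · exact (hBe.false b).elim
    · simp only [Sum.elim_inr, ne_eq, ite_eq_right_iff, one_ne_zero, imp_false, not_not] at hx
      simpa [cubeIn] using hx
  · -- hw1
    intro τ
    rcases τ with b | Y
    · exact (hBe.false b).elim
    · simp only [Sum.elim_inr]
      rw [Finset.sum_boole]
      have hle : (univ.filter fun x : BIJ88PolymerRep5134Gauss.Site (fun x : Fin 2 => x) (univ : Finset (Fin 2)) => x.1 = 0).card ≤ 1 :=
        card_le_one.2 fun a ha b hb => by
          have ha' : a.1 = 0 := (mem_filter.1 ha).2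
          have hb' : b.1 = 0 := (mem_filter.1 hb).2
          exact Subtype.ext (ha'.trans hb'.symm)
      exact_mod_cast hle
  · -- hp₁: the per-train smallness
    have hE : Real.exp (-1500) * Real.exp (1 / 10 * (2 * 7000 - (0 + 2))) ≤ ((2 : ℝ) ^ 100)⁻¹ := by
      rw [← Real.exp_add, show (-1500 : ℝ) + 1 / 10 * (2 * 7000 - (0 + 2)) = -(501 / 5) by norm_num]
      exact exp_neg_le_inv_two_pow (by norm_num)
    refine p1_aux (by positivity) ?_ hE hl0.le (Real.exp_pos _).le
    rw [max_eq_right (zero_le_one' ℝ), zero_mul, Real.exp_zero, one_mul, one_mul, mul_one]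
    linarith [hquarter]
  · -- hsmallG: sparseness
    have e4 : Real.exp (-(1 / 2 / 2 / 2 * (2 * 7000 - (0 + 2)))) * Real.exp (1 / 2 / 2 / 2 * (0 + 2)) ≤ ((2 : ℝ) ^ 20)⁻¹ := by
      refine (le_of_eq ?_).trans (exp_neg_le_inv_two_pow (x := 3499 / 2) (n := 20) (by norm_num))
      rw [← Real.exp_add]
      congr 1
      norm_num
    calc _ = 2 * (((2 * 2 + 1).factorial : ℕ) : ℝ) * (2 * 2) *
          (Real.exp (-(1 / 2 / 2 / 2 * (2 * 7000 - (0 + 2)))) * Real.exp (1 / 2 / 2 / 2 * (0 + 2))) := by ring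
      _ ≤ 2 * (((2 * 2 + 1).factorial : ℕ) : ℝ) * (2 * 2) * ((2 : ℝ) ^ 20)⁻¹ := by gcongr
      _ ≤ 1 := by norm_num [Nat.factorial]
  · -- hρ: the per-block ratio — the tension e^{2(c₀+1)!} vs q
    have e3 : Real.exp (1 / 2 * 1) * Real.exp (-(1 / 10 * (2 * 7000 - (0 + 2)) / ((2 * 2 : ℕ) + 1))) *
        Real.exp (2 * (((2 * 2 + 1).factorial : ℕ) : ℝ)) ≤ ((2 : ℝ) ^ 39)⁻¹ := by
      refine (le_of_eq ?_).trans (exp_neg_le_inv_two_pow (x := 1973 / 50) (n := 39) (by norm_num))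
      rw [← Real.exp_add, ← Real.exp_add]
      congr 1
      norm_num [Nat.factorial]
    calc _ = 2 / (99 / 100 : ℝ) * 2 * (2 * (1 / 100) * 1) * (Real.exp (1 / 2 * 1) *
          Real.exp (-(1 / 10 * (2 * 7000 - (0 + 2)) / ((2 * 2 : ℕ) + 1))) * Real.exp (2 * (((2 * 2 + 1).factorial : ℕ) : ℝ))) := by ring
      _ ≤ 2 / (99 / 100 : ℝ) * 2 * (2 * (1 / 100) * 1) * ((2 : ℝ) ^ 39)⁻¹ := by gcongr
      _ ≤ (1 / 100 : ℝ) ^ 2 := by norm_num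

end Literature.MathematicalPhysics.QuantumFieldTheory.BalabanImbrieJaffe1984to88.BIJ88Ineq5144SizeFreeCoupledToy

end
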